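import Literature.Topology.FourManifolds.CerfSphereCriticalSet
import Literature.Topology.FourManifolds.CerfCriticalSet
import HarnessLib

/-!
# The structure of a generic path of spheres: finitely many events (Cerf 1968, Ch. II §2
# Prop. 3–3′ and §3 Prop. 7: an excellent path meets the codimension-one stratum finitely
# often, and is otherwise made of excellent spheres)

Topic `Literature/Topology/FourManifolds` (programme of the fact
`Literature.Topology.FourManifolds.cerf_pi0DiffDisc_relBoundary_three`, brick C1, structure layer 3).
Cerf (LNM 53 (1968), Ch. II §2, Prop. 3 and 3′): a path of functions is excellent iff it is
correct, lies in `𝒳⁰ ∪ 𝒳¹` and meets `𝒳¹` (the codimension-one stratum: `𝒳¹_α` one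
birth–death point with all critical values distinct, `𝒳¹_β` Morse with exactly two equal
critical values) at finitely many times, transversally; §3 Prop. 7 transports this to paths of
embedded spheres through the height `ϖ ∘ j`.  This file derives that structure for a smooth
family `F : ℝ → ℝ³ → ℝ³` moving the unit sphere from the seven pointwise conditions of
`CerfSphereGenericity.ae_genericity_sphere`, here packaged as `GenericConditions F` for the
UNPERTURBED chart readings `heightChart F s` (apply it to the sheared family):

* `GenericConditions` — the seven conditions (T0′), (Déf. 1), (C₁)–(C₅) in the two charts;
* `hessDet_ne_zero_of_transverse_double` — (C₁) forces both points of an equal-valued pair of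
  distinct critical points to be nondegenerate (a degenerate Hessian and the common slope kill
  a functional on the target of Cerf's map `(λ, x, x′) ↦ (p, q, p′, q′, z - z′)`);
* representatives: `eq_inversion_of_stereoInv_eq`, and the chart-independence of criticality
  and degeneracy of a point of the sphere (`d1_eq_zero_of_stereoInv_eq`,
  `hessDet_eq_zero_iff_of_stereoInv_eq`, from the (I1)–(I2) transfer of
  `CerfSphereCriticalSet`);
* `critSet F t` — the critical points of the height on the sphere `F t (S²)`, pulled back to
  `S²`; `finite_critSet`: **under the generic conditions every slice has finitely many critical
  points**; `IsDegenerate`, `events F` — the times with a degenerate critical point or two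
  distinct critical points at the same height;
* consequences at one time: two degenerate critical points coincide (`stereoInv_eq_of_degenerate`),
  a degenerate critical point shares its height with no other critical point
  (`height_ne_of_degenerate`), at a birth–death time no two distinct critical points have the
  same height (`height_ne_of_exists_degenerate`);
* `chart_local_structure` — near a time `λ₀`, in one chart: the nondegenerate critical points
  at `λ₀` with their smooth continuations, the birth–death centre (if any), and the accounting
  of all critical chart points of the closed unit disc at nearby times (`CerfCriticalSet`);
* `eventually_not_mem_events` — **the events are isolated**: near every `λ₀` no `λ ≠ λ₀` is an
  event (continuations stay nondegenerate with heights distinct or crossing transversally by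
  (C₁); the birth–death cluster is nondegenerate off `λ₀` with pairwise distinct heights by
  Lemme 8, close to the birth–death height which differs from all other critical heights);
* `finite_events_inter_Icc` — **on every compact time interval a generic path has finitely
  many events** (Cerf's Prop. 3′: an excellent path meets `𝒳¹` at finitely many times).

## References
* [CerfDiffeoSphere1968] J. Cerf, *Sur les difféomorphismes de la sphère de dimension trois
  (Γ₄ = 0)*, LNM 53 (1968), Ch. II §2, Déf. 1–2, Prop. 3, 3′, 4; §3, Prop. 7.
-/

noncomputable section

open Set Function Filter Module Metric
open scoped ContDiff Topology BigOperators

namespace Literature.Topology.FourManifolds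

namespace CerfPath

open Literature.Analysis.Calculus Literature.Analysis.Calculus.ParametricTransversality

/-- Local notation: the model plane. -/
local notation "𝔼²" => EuclideanSpace ℝ (Fin 2)
/-- Local notation: the ambient space. -/
local notation "𝔼³" => EuclideanSpace ℝ (Fin 3)

/-! ### (C₁) forces nondegeneracy at a double value -/

section TransverseDouble

variable {fa fb : ℝ × 𝔼² → ℝ} {t : ℝ} {x y : 𝔼²}

/-- **At a transverse double value both critical points are nondegenerate** ("les points
doubles du graphique sont distincts des points de rebroussement").  If `x` is critical for the
slice of `fa` and `y` for that of `fb` at the same `λ` and Cerf's map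
`(λ, x, x′) ↦ (p, q, p′, q′, z - z′)` has onto derivative there, then `δ(fa)(λ, x) ≠ 0`: a
kernel vector `k` of the Hessian would make `(k, 0, 0)` miss the range, since the `λ`-component
of a preimage must vanish (the slopes differ, `dt_ne_dt_of_transverse_double`) and then
`⟨Hess·v, k⟩ = 0 ≠ |k|²`. [cite: CerfDiffeoSphere1968, Ch. II §2, Description de C₁] -/
theorem hessDet_ne_zero_of_transverse_double (hfa : ContDiff ℝ ∞ fa) (hfb : ContDiff ℝ ∞ fb)
    (hca : d1 fa (t, x) = 0) (hcb : d1 fb (t, y) = 0)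
    (hsurj : Surjective (fderiv ℝ (fun q : ℝ × (𝔼² × 𝔼²) =>
      (d1 fa (q.1, q.2.1), d1 fb (q.1, q.2.2), fa (q.1, q.2.1) - fb (q.1, q.2.2))) (t, (x, y)))) :
    hessDet fa (t, x) ≠ 0 := by
  intro hδ
  have hμ : dt fa (t, x) ≠ dt fb (t, y) := dt_ne_dt_of_transverse_double hfa hfb hca hcb hsurj
  -- a kernel vector of the Hessian of the slice of `fa`
  have hδ' : d2 fa (t, x) 0 0 * d2 fa (t, x) 1 1 - d2 fa (t, x) 0 1 ^ 2 = 0 := hδ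
  obtain ⟨k, hk, hk0, hk1⟩ := exists_kernel hδ'
  -- the derivative of Cerf's map
  have hfa1 : Differentiable ℝ fa := hfa.differentiable (by simp)
  have hfb1 : Differentiable ℝ fb := hfb.differentiable (by simp)
  obtain ⟨Pa, hPa⟩ : ∃ Pa : ℝ × (𝔼² × 𝔼²) →L[ℝ] ℝ × 𝔼²,
      Pa = (ContinuousLinearMap.fst ℝ ℝ (𝔼² × 𝔼²)).prod
        (ContinuousLinearMap.fst ℝ 𝔼² 𝔼² ∘L ContinuousLinearMap.snd ℝ ℝ (𝔼² × 𝔼²)) := ⟨_, rfl⟩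
  obtain ⟨Pb, hPb⟩ : ∃ Pb : ℝ × (𝔼² × 𝔼²) →L[ℝ] ℝ × 𝔼²,
      Pb = (ContinuousLinearMap.fst ℝ ℝ (𝔼² × 𝔼²)).prod
        (ContinuousLinearMap.snd ℝ 𝔼² 𝔼² ∘L ContinuousLinearMap.snd ℝ ℝ (𝔼² × 𝔼²)) := ⟨_, rfl⟩
  have hPa' : HasFDerivAt (fun q : ℝ × (𝔼² × 𝔼²) => ((q.1, q.2.1) : ℝ × 𝔼²)) Pa (t, (x, y)) := by
    rw [hPa]; exact hasFDerivAt_fst.prodMk (hasFDerivAt_fst.comp _ hasFDerivAt_snd)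
  have hPb' : HasFDerivAt (fun q : ℝ × (𝔼² × 𝔼²) => ((q.1, q.2.2) : ℝ × 𝔼²)) Pb (t, (x, y)) := by
    rw [hPb]; exact hasFDerivAt_fst.prodMk (hasFDerivAt_snd.comp _ hasFDerivAt_snd)
  have hda1 : ∀ i, Differentiable ℝ fun z : ℝ × 𝔼² => d1 fa z i := fun i =>
    (contDiff_d1 hfa i).differentiable (by simp)
  have hdb1 : ∀ i, Differentiable ℝ fun z : ℝ × 𝔼² => d1 fb z i := fun i =>
    (contDiff_d1 hfb i).differentiable (by simp)
  have hA1 : HasFDerivAt (fun q : ℝ × (𝔼² × 𝔼²) => d1 fa (q.1, q.2.1))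
      (ContinuousLinearMap.pi fun i => (fderiv ℝ (fun z => d1 fa z i) (t, x)).comp Pa)
      (t, (x, y)) := by
    refine hasFDerivAt_pi.2 fun i => ?_
    exact ((hda1 i (t, x)).hasFDerivAt).comp (t, (x, y)) hPa'
  have hB1 : HasFDerivAt (fun q : ℝ × (𝔼² × 𝔼²) => d1 fb (q.1, q.2.2))
      (ContinuousLinearMap.pi fun i => (fderiv ℝ (fun z => d1 fb z i) (t, y)).comp Pb)
      (t, (x, y)) := by
    refine hasFDerivAt_pi.2 fun i => ?_
    exact ((hdb1 i (t, y)).hasFDerivAt).comp (t, (x, y)) hPb'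
  have hA : HasFDerivAt (fun q : ℝ × (𝔼² × 𝔼²) => fa (q.1, q.2.1))
      (fderiv ℝ fa (t, x) ∘L Pa) (t, (x, y)) := ((hfa1 (t, x)).hasFDerivAt).comp (t, (x, y)) hPa'
  have hB : HasFDerivAt (fun q : ℝ × (𝔼² × 𝔼²) => fb (q.1, q.2.2))
      (fderiv ℝ fb (t, y) ∘L Pb) (t, (x, y)) := ((hfb1 (t, y)).hasFDerivAt).comp (t, (x, y)) hPb'
  have hfull := hA1.prodMk (hB1.prodMk (hA.fun_sub hB))
  rw [hfull.fderiv] at hsurj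
  -- the vector `(k, 0, 0)` is attained
  obtain ⟨w, hw⟩ := hsurj ((fun i => k i), 0, 0)
  obtain ⟨τ, v, v'⟩ := w
  have h3 := congrArg (fun u => u.2.2) hw
  have h1 := congrArg (fun u => u.1) hw
  simp only [ContinuousLinearMap.prod_apply] at h3 h1
  -- third component: `τ (μ - μ′) = 0`, so `τ = 0`
  have hτ : τ = 0 := by
    have h3' : fderiv ℝ fa (t, x) (Pa (τ, (v, v'))) - fderiv ℝ fb (t, y) (Pb (τ, (v, v'))) = 0 := by
      simpa using h3
    rw [hPa, hPb] at h3'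
    simp only [ContinuousLinearMap.prod_apply, ContinuousLinearMap.coe_fst',
      ContinuousLinearMap.coe_comp, Function.comp_apply, ContinuousLinearMap.coe_snd'] at h3'
    rw [fderiv_apply_of_critical (t, x) hca, fderiv_apply_of_critical (t, y) hcb, ← mul_sub] at h3'
    exact (mul_eq_zero.1 h3').resolve_right (sub_ne_zero.2 hμ)
  -- first component: `Hess · v = k`
  have hcomp : ∀ i, hessMul fa (t, x) v i = k i := by
    intro i
    have h := congrFun h1 i
    simp only [ContinuousLinearMap.pi_apply, ContinuousLinearMap.coe_comp, Function.comp_apply]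
      at h
    rw [hPa] at h
    simp only [ContinuousLinearMap.prod_apply, ContinuousLinearMap.coe_fst',
      ContinuousLinearMap.coe_comp, Function.comp_apply, ContinuousLinearMap.coe_snd'] at h
    rw [fderiv_d1_apply hfa two_le_infty (t, x) τ v i, hτ, zero_mul, zero_add,
      sum_mul_d2_eq_hessMul hfa] at h
    exact h
  -- `⟨Hess·v, k⟩ = 0` but `= |k|²`
  have hs : d2 fa (t, x) 1 0 = d2 fa (t, x) 0 1 := d2_symm hfa.contDiffAt two_le_infty 1 0
  have e0 := hcomp 0
  have e1 := hcomp 1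
  rw [hessMul_apply] at e0 e1
  rw [hs] at e1
  have hker := kernel_inner_hess_apply hk0 hk1 (v 0) (v 1)
  rw [e0, e1] at hker
  have hk00 : k 0 = 0 := by nlinarith [sq_nonneg (k 0), sq_nonneg (k 1)]
  have hk11 : k 1 = 0 := by nlinarith [sq_nonneg (k 0), sq_nonneg (k 1)]
  apply hk
  ext i; fin_cases i <;> simp [hk00, hk11]

end TransverseDouble

/-! ### Representatives of a point of the sphere in the two charts -/

/-- Two chart representatives of the same point of the sphere in different charts are related
by the inversion, and are off the centres. [folklore] -/
theorem eq_inversion_of_stereoInv_eq {a b : Fin 2} (hab : a ≠ b) {x y : 𝔼²}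
    (h : stereoInv a x = stereoInv b y) : x ≠ 0 ∧ y = sphereInversion x := by
  have hx : x ≠ 0 := by
    intro hx0
    -- the centre of chart `a` is the pole of chart `b`, which is not in the image of chart `b`
    have h2 := congrArg (fun ξ : 𝔼³ => ξ 2) h
    simp only at h2
    rw [stereoInv_apply_two, stereoInv_apply_two, hx0, norm_zero, pole_eq_neg_pole hab] at h2
    have hr := one_add_norm_sq_pos y
    have hc : (1 + ‖y‖ ^ 2)⁻¹ * (1 + ‖y‖ ^ 2) = 1 := inv_mul_cancel₀ hr.ne'
    have hp : pole a ≠ 0 := by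
      have := pole_mul_self a; intro h0; rw [h0, mul_zero] at this; exact zero_ne_one this
    -- `-pole a = (1+‖y‖²)⁻¹ (-pole a) (‖y‖² - 1)` forces `(1+‖y‖²) = -(‖y‖²-1)`… impossible
    have h3 : (1 + ‖y‖ ^ 2)⁻¹ * (‖y‖ ^ 2 - 1) = 1 := by
      have h2' : -pole a * 1 = -pole a * ((1 + ‖y‖ ^ 2)⁻¹ * (‖y‖ ^ 2 - 1)) := by
        simp only [zero_pow two_ne_zero, zero_sub, mul_neg, mul_one] at h2
        linear_combination h2
      have := mul_left_cancel₀ (neg_ne_zero.2 hp) h2'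
      exact this.symm
    have h4 : ‖y‖ ^ 2 - 1 = 1 + ‖y‖ ^ 2 := by
      have := congrArg (fun r => (1 + ‖y‖ ^ 2) * r) h3
      simp only [mul_one] at this
      rw [← mul_assoc, mul_inv_cancel₀ hr.ne', one_mul] at this
      exact this
    linarith
  refine ⟨hx, injective_stereoInv b ?_⟩
  rw [stereoInv_inversion hab hx]
  exact h.symm

variable {F : ℝ → 𝔼³ → 𝔼³}

/-- **Criticality of a point of the sphere is independent of the representative.**
[cite: CerfDiffeoSphere1968, Ch. II §3] -/
theorem d1_eq_zero_of_stereoInv_eq (hF : ContDiff ℝ ∞ (uncurry F)) {a b : Fin 2} {t : ℝ}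
    {x y : 𝔼²} (h : stereoInv a x = stereoInv b y) (hcrit : d1 (heightChart F a) (t, x) = 0) :
    d1 (heightChart F b) (t, y) = 0 := by
  by_cases hab : a = b
  · subst hab
    rw [← injective_stereoInv a h]; exact hcrit
  · obtain ⟨hx, rfl⟩ := eq_inversion_of_stereoInv_eq hab h
    exact (d1_heightChart_eq_zero_iff hF hab t hx).1 hcrit

/-- **Degeneracy of a critical point of the sphere is independent of the representative.**
[cite: CerfDiffeoSphere1968, Ch. II §3] -/
theorem hessDet_eq_zero_iff_of_stereoInv_eq (hF : ContDiff ℝ ∞ (uncurry F)) {a b : Fin 2}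
    {t : ℝ} {x y : 𝔼²} (h : stereoInv a x = stereoInv b y)
    (hcrit : d1 (heightChart F a) (t, x) = 0) :
    hessDet (heightChart F a) (t, x) = 0 ↔ hessDet (heightChart F b) (t, y) = 0 := by
  by_cases hab : a = b
  · subst hab
    rw [← injective_stereoInv a h]
  · obtain ⟨hx, rfl⟩ := eq_inversion_of_stereoInv_eq hab h
    exact hessDet_heightChart_eq_zero_iff hF hab t hx hcrit

/-- The height of a point of the moving sphere in a chart is its third coordinate. [folklore] -/
theorem heightChart_eq_apply (F : ℝ → 𝔼³ → 𝔼³) (s : Fin 2) (t : ℝ) (x : 𝔼²) :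
    heightChart F s (t, x) = (F t (stereoInv s x)) 2 := rfl

/-! ### The seven generic conditions -/

/-- **Cerf's genericity conditions for the height functions of a moving sphere, read in the two
stereographic charts** (the conclusions of `CerfSphereGenericity.ae_genericity_sphere` for the
unperturbed readings; they hold for the sheared family `t ↦ shear_p ∘ F t` for a.e. `p`):
(T0′) no critical point with vanishing second jet; (Déf. 1) correctness at degenerate critical
points; (C₁) transverse double values; (C₂) at most one degenerate critical point per slice;
(C₃) no triple values; (C₄) no degenerate critical point together with a double value; (C₅) no
two double values. [cite: CerfDiffeoSphere1968, Ch. II §2, Déf. 1–2; §3, Prop. 7] -/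
structure GenericConditions (F : ℝ → 𝔼³ → 𝔼³) : Prop where
  /-- (T0′): at a critical point of a slice the second jet does not vanish. -/
  jet2_ne : ∀ (s : Fin 2) (z : ℝ × 𝔼²), d1 (heightChart F s) z = 0 → jet2 (heightChart F s) z ≠ 0
  /-- (Déf. 1): correctness at degenerate critical points. -/
  correct : ∀ (s : Fin 2) (z : ℝ × 𝔼²), jet2 (heightChart F s) z ≠ 0 →
    d1 (heightChart F s) z = 0 → hessDet (heightChart F s) z = 0 →
    Surjective (fderiv ℝ (fun z => (d1 (heightChart F s) z, hessDet (heightChart F s) z)) z)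
  /-- (C₁): transverse double values. -/
  transverse : ∀ (a b : Fin 2) (t : ℝ) (x y : 𝔼²), stereoInv a x ≠ stereoInv b y →
    d1 (heightChart F a) (t, x) = 0 → d1 (heightChart F b) (t, y) = 0 →
    heightChart F a (t, x) = heightChart F b (t, y) →
    Surjective (fderiv ℝ (fun q : ℝ × (𝔼² × 𝔼²) =>
      (d1 (heightChart F a) (q.1, q.2.1), d1 (heightChart F b) (q.1, q.2.2),
        heightChart F a (q.1, q.2.1) - heightChart F b (q.1, q.2.2))) (t, (x, y)))
  /-- (C₂): at most one degenerate critical point per slice. -/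
  atMostOne : ∀ (a b : Fin 2) (t : ℝ) (x y : 𝔼²), stereoInv a x ≠ stereoInv b y →
    jet2 (heightChart F a) (t, x) ≠ 0 → jet2 (heightChart F b) (t, y) ≠ 0 →
    ¬ (d1 (heightChart F a) (t, x) = 0 ∧ hessDet (heightChart F a) (t, x) = 0 ∧
       d1 (heightChart F b) (t, y) = 0 ∧ hessDet (heightChart F b) (t, y) = 0)
  /-- (C₃): no three distinct critical points with the same height. -/
  noTriple : ∀ (a b c : Fin 2) (t : ℝ) (x y u : 𝔼²),
    stereoInv a x ≠ stereoInv b y → stereoInv a x ≠ stereoInv c u →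
    stereoInv b y ≠ stereoInv c u →
    ¬ (d1 (heightChart F a) (t, x) = 0 ∧ d1 (heightChart F b) (t, y) = 0 ∧
       d1 (heightChart F c) (t, u) = 0 ∧
       heightChart F a (t, x) = heightChart F b (t, y) ∧
       heightChart F b (t, y) = heightChart F c (t, u))
  /-- (C₄): no degenerate critical point together with an equal-valued pair. -/
  noDegenerateDouble : ∀ (a b c : Fin 2) (t : ℝ) (x y u : 𝔼²),
    stereoInv a x ≠ stereoInv b y → stereoInv a x ≠ stereoInv c u →
    stereoInv b y ≠ stereoInv c u → jet2 (heightChart F c) (t, u) ≠ 0 →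
    ¬ (d1 (heightChart F a) (t, x) = 0 ∧ d1 (heightChart F b) (t, y) = 0 ∧
       heightChart F a (t, x) = heightChart F b (t, y) ∧
       d1 (heightChart F c) (t, u) = 0 ∧ hessDet (heightChart F c) (t, u) = 0)
  /-- (C₅): no two equal-valued pairs in one slice. -/
  noTwoDoubles : ∀ (a b c e : Fin 2) (t : ℝ) (x y u v : 𝔼²),
    stereoInv a x ≠ stereoInv b y → stereoInv a x ≠ stereoInv c u →
    stereoInv a x ≠ stereoInv e v → stereoInv b y ≠ stereoInv c u →
    stereoInv b y ≠ stereoInv e v → stereoInv c u ≠ stereoInv e v →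
    ¬ (d1 (heightChart F a) (t, x) = 0 ∧ d1 (heightChart F b) (t, y) = 0 ∧
       d1 (heightChart F c) (t, u) = 0 ∧ d1 (heightChart F e) (t, v) = 0 ∧
       heightChart F a (t, x) = heightChart F b (t, y) ∧
       heightChart F c (t, u) = heightChart F e (t, v))

/-! ### Consequences at one time -/

section Static

variable (hF : ContDiff ℝ ∞ (uncurry F)) (hG : GenericConditions F)
include hF hG

omit hF in
/-- **(C₂) with (T0′): two degenerate critical chart points of one slice represent the same
point of the sphere.** [cite: CerfDiffeoSphere1968, Ch. II §2, Description de C₂] -/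
theorem stereoInv_eq_of_degenerate {a b : Fin 2} {t : ℝ} {x y : 𝔼²}
    (hca : d1 (heightChart F a) (t, x) = 0) (hda : hessDet (heightChart F a) (t, x) = 0)
    (hcb : d1 (heightChart F b) (t, y) = 0) (hdb : hessDet (heightChart F b) (t, y) = 0) :
    stereoInv a x = stereoInv b y := by
  by_contra hne
  exact hG.atMostOne a b t x y hne (hG.jet2_ne a _ hca) (hG.jet2_ne b _ hcb) ⟨hca, hda, hcb, hdb⟩

/-- **(C₁): a degenerate critical point shares its height with no other critical point of the
slice.** [cite: CerfDiffeoSphere1968, Ch. II §2, Description de C₁] -/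
theorem height_ne_of_degenerate {a b : Fin 2} {t : ℝ} {x y : 𝔼²}
    (hne : stereoInv a x ≠ stereoInv b y)
    (hca : d1 (heightChart F a) (t, x) = 0) (hda : hessDet (heightChart F a) (t, x) = 0)
    (hcb : d1 (heightChart F b) (t, y) = 0) :
    heightChart F a (t, x) ≠ heightChart F b (t, y) := by
  intro heq
  have hsurj := hG.transverse a b t x y hne hca hcb heq
  exact hessDet_ne_zero_of_transverse_double (contDiff_heightChart hF a) (contDiff_heightChart hF b)
    hca hcb hsurj hda

/-- **(C₁): at a double value of distinct critical points both points are nondegenerate.**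
[cite: CerfDiffeoSphere1968, Ch. II §2, Description de C₁] -/
theorem hessDet_ne_zero_of_double {a b : Fin 2} {t : ℝ} {x y : 𝔼²}
    (hne : stereoInv a x ≠ stereoInv b y)
    (hca : d1 (heightChart F a) (t, x) = 0) (hcb : d1 (heightChart F b) (t, y) = 0)
    (heq : heightChart F a (t, x) = heightChart F b (t, y)) :
    hessDet (heightChart F a) (t, x) ≠ 0 := fun hda =>
  height_ne_of_degenerate hF hG hne hca hda hcb heq

/-- **(C₁): at a double value the two slopes differ** (`μ ≠ μ′`).
[cite: CerfDiffeoSphere1968, Ch. II §2, (13)] -/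
theorem dt_ne_of_double {a b : Fin 2} {t : ℝ} {x y : 𝔼²}
    (hne : stereoInv a x ≠ stereoInv b y)
    (hca : d1 (heightChart F a) (t, x) = 0) (hcb : d1 (heightChart F b) (t, y) = 0)
    (heq : heightChart F a (t, x) = heightChart F b (t, y)) :
    dt (heightChart F a) (t, x) ≠ dt (heightChart F b) (t, y) :=
  dt_ne_dt_of_transverse_double (contDiff_heightChart hF a) (contDiff_heightChart hF b) hca hcb
    (hG.transverse a b t x y hne hca hcb heq)

/-- **(C₄) with (C₁): at a time with a degenerate critical point, no two distinct critical
points have the same height.** [cite: CerfDiffeoSphere1968, Ch. II §2, Description de C₄] -/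
theorem height_ne_of_exists_degenerate {c : Fin 2} {t : ℝ} {u : 𝔼²}
    (hcc : d1 (heightChart F c) (t, u) = 0) (hdc : hessDet (heightChart F c) (t, u) = 0)
    {a b : Fin 2} {x y : 𝔼²} (hne : stereoInv a x ≠ stereoInv b y)
    (hca : d1 (heightChart F a) (t, x) = 0) (hcb : d1 (heightChart F b) (t, y) = 0) :
    heightChart F a (t, x) ≠ heightChart F b (t, y) := by
  intro heq
  -- the degenerate point is distinct from both (else it would be nondegenerate by (C₁))
  by_cases hac : stereoInv a x = stereoInv c u
  · have hda : hessDet (heightChart F a) (t, x) = 0 :=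
      (hessDet_eq_zero_iff_of_stereoInv_eq hF hac hca).2 hdc
    exact hessDet_ne_zero_of_double hF hG hne hca hcb heq hda
  by_cases hbc : stereoInv b y = stereoInv c u
  · have hdb : hessDet (heightChart F b) (t, y) = 0 :=
      (hessDet_eq_zero_iff_of_stereoInv_eq hF hbc hcb).2 hdc
    exact hessDet_ne_zero_of_double hF hG (Ne.symm hne) hcb hca heq.symm hdb
  exact hG.noDegenerateDouble a b c t x y u hne hac hbc (hG.jet2_ne c _ hcc) ⟨hca, hcb, heq, hcc, hdc⟩

end Static

/-! ### The critical set of a slice and the events -/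

/-- The critical points at time `t` of the height of the moving sphere, pulled back to the unit
sphere: the images of the critical chart points of the two closed unit discs (which cover the
sphere, `exists_stereoInv_eq_of_mem_sphere`). [cite: CerfDiffeoSphere1968, Ch. II §2–3] -/
def critSet (F : ℝ → 𝔼³ → 𝔼³) (t : ℝ) : Set 𝔼³ :=
  {ξ | ∃ (s : Fin 2) (x : 𝔼²), ‖x‖ ≤ 1 ∧ stereoInv s x = ξ ∧ d1 (heightChart F s) (t, x) = 0}

/-- A point of the sphere is a DEGENERATE critical point at time `t` if some (equivalently,
by `hessDet_eq_zero_iff_of_stereoInv_eq`, every) chart representative is a critical point of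
the slice with vanishing Hessian determinant. [cite: CerfDiffeoSphere1968, Ch. II §2] -/
def IsDegenerate (F : ℝ → 𝔼³ → 𝔼³) (t : ℝ) (ξ : 𝔼³) : Prop :=
  ∃ (s : Fin 2) (x : 𝔼²), stereoInv s x = ξ ∧ d1 (heightChart F s) (t, x) = 0 ∧
    hessDet (heightChart F s) (t, x) = 0

/-- The EVENTS of the path: the times at which the sphere `F t (S²)` is not excellent — a
degenerate critical point of the height, or two distinct critical points at the same height
(Cerf's `𝒳¹_α ∪ 𝒳¹_β` and worse). [cite: CerfDiffeoSphere1968, Ch. II §2, Prop. 3] -/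
def events (F : ℝ → 𝔼³ → 𝔼³) : Set ℝ :=
  {t | (∃ ξ ∈ critSet F t, IsDegenerate F t ξ) ∨
    (∃ ξ ∈ critSet F t, ∃ ξ' ∈ critSet F t, ξ ≠ ξ' ∧ (F t ξ) 2 = (F t ξ') 2)}

/-- Points of `critSet` lie on the unit sphere. [folklore] -/
theorem mem_sphere_of_mem_critSet {t : ℝ} {ξ : 𝔼³} (h : ξ ∈ critSet F t) :
    ξ ∈ Metric.sphere (0 : 𝔼³) 1 := by
  obtain ⟨s, x, -, rfl, -⟩ := h
  exact stereoInv_mem_sphere s x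

/-- **Every representative of a critical point of the sphere is a critical chart point.**
[folklore] -/
theorem d1_eq_zero_of_mem_critSet (hF : ContDiff ℝ ∞ (uncurry F)) {t : ℝ} {ξ : 𝔼³}
    (h : ξ ∈ critSet F t) {s : Fin 2} {x : 𝔼²} (hx : stereoInv s x = ξ) :
    d1 (heightChart F s) (t, x) = 0 := by
  obtain ⟨a, y, -, rfl, hcrit⟩ := h
  exact d1_eq_zero_of_stereoInv_eq hF hx.symm hcrit

/-- A critical chart point (any norm) represents a point of `critSet`. [folklore] -/
theorem stereoInv_mem_critSet (hF : ContDiff ℝ ∞ (uncurry F)) {t : ℝ} {s : Fin 2} {x : 𝔼²}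
    (hcrit : d1 (heightChart F s) (t, x) = 0) : stereoInv s x ∈ critSet F t := by
  obtain ⟨a, y, hy, hya⟩ := exists_stereoInv_eq_of_mem_sphere (stereoInv_mem_sphere s x)
  exact ⟨a, y, hy, hya, d1_eq_zero_of_stereoInv_eq hF hya.symm hcrit⟩

/-- **Under the generic conditions every slice has finitely many critical points.**
[cite: CerfDiffeoSphere1968, Ch. II §2, Déf. 1 (critical points of a correct path are isolated in each slice)] -/
theorem finite_critSet (hF : ContDiff ℝ ∞ (uncurry F)) (hG : GenericConditions F) (t : ℝ) :
    (critSet F t).Finite := by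
  -- the chart critical sets in the closed unit discs are finite
  have hfin : ∀ s : Fin 2, {x ∈ closedBall (0 : 𝔼²) 1 | d1 (heightChart F s) (t, x) = 0}.Finite := by
    intro s
    have hFs : ContDiff ℝ ∞ fun p : ℝ × (ℝ × 𝔼²) => (fun _ : ℝ => heightChart F s) p.1 p.2 := by
      have h := (contDiff_heightChart hF s).comp (contDiff_snd : ContDiff ℝ ∞ (Prod.snd : ℝ × (ℝ × 𝔼²) → ℝ × 𝔼²))
      exact h
    refine finite_criticalSet (F := fun _ : ℝ => heightChart F s) hFs (isCompact_closedBall 0 1) t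
      fun x _ hc => ?_
    by_cases hδ : hessDet (heightChart F s) (t, x) = 0
    · exact Or.inr ⟨hG.jet2_ne s _ hc, hG.correct s _ (hG.jet2_ne s _ hc) hc hδ⟩
    · exact Or.inl hδ
  have hsub : critSet F t ⊆ ⋃ s : Fin 2,
      (fun x => stereoInv s x) '' {x ∈ closedBall (0 : 𝔼²) 1 | d1 (heightChart F s) (t, x) = 0} := by
    rintro ξ ⟨s, x, hx, rfl, hc⟩
    exact mem_iUnion.2 ⟨s, mem_image_of_mem _ ⟨mem_closedBall_zero_iff.2 hx, hc⟩⟩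
  exact (Set.finite_iUnion fun s => (hfin s).image _).subset hsub

/-! ### Local structure in one chart near a time -/

section Local

variable (hF : ContDiff ℝ ∞ (uncurry F)) (hG : GenericConditions F)
include hF hG

omit hG in
/-- The chart readings as constant-in-`u` families (the format of `CerfCriticalSet`).
[folklore] -/
theorem contDiff_heightChart_family (s : Fin 2) :
    ContDiff ℝ ∞ fun p : ℝ × (ℝ × 𝔼²) => (fun _ : ℝ => heightChart F s) p.1 p.2 := by
  have h := (contDiff_heightChart hF s).comp
    (contDiff_snd : ContDiff ℝ ∞ (Prod.snd : ℝ × (ℝ × 𝔼²) → ℝ × 𝔼²))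
  exact h

/-- **Near a generic birth–death chart point**: a radius within which the birth–death point is
the only degenerate critical point (in `(λ, x)` jointly) and two distinct critical points of one
slice have distinct heights (Lemme 8). [cite: CerfDiffeoSphere1968, Ch. II §2, 2° and Lemme 8] -/
theorem exists_cluster_radius {s : Fin 2} {t₀ : ℝ} {x₀ : 𝔼²}
    (hc : d1 (heightChart F s) (t₀, x₀) = 0) (hd : hessDet (heightChart F s) (t₀, x₀) = 0) :
    ∃ ε > 0,
      (∀ z : ℝ × 𝔼², dist z (t₀, x₀) < ε → d1 (heightChart F s) z = 0 →
        hessDet (heightChart F s) z = 0 → z = (t₀, x₀)) ∧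
      (∀ z z' : ℝ × 𝔼², dist z (t₀, x₀) < ε → dist z' (t₀, x₀) < ε →
        d1 (heightChart F s) z = 0 → d1 (heightChart F s) z' = 0 → z ≠ z' → z.1 = z'.1 →
        heightChart F s z ≠ heightChart F s z') := by
  have hj := hG.jet2_ne s _ hc
  have hcorr := hG.correct s _ hj hc hd
  obtain ⟨ε₁, hε₁, h₁⟩ := Metric.eventually_nhds_iff.1
    (eventually_not_degenerate (contDiff_heightChart hF s) hc hd hcorr)
  obtain ⟨ε₂, hε₂, h₂⟩ := exists_nhds_critical_values_ne (F := fun _ : ℝ => heightChart F s)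
    (z₀ := (t₀, x₀)) (contDiff_heightChart_family hF s) hc hd hj hcorr
  refine ⟨min ε₁ ε₂, lt_min hε₁ hε₂, fun z hz hcz hdz => h₁ (hz.trans_le (min_le_left _ _)) hcz hdz,
    fun z z' hz hz' hcz hcz' hne h1 => ?_⟩
  exact h₂ 0 z z' (by simpa using hε₂) (hz.trans_le (min_le_right _ _))
    (hz'.trans_le (min_le_right _ _)) hcz hcz' hne h1

/-- **Local structure of the critical set of the slices in one chart near a time `λ₀`**
(packaging of `CerfCriticalSet` for the sphere): a finite set `S` of nondegenerate critical
chart points at `λ₀` with their continuations `η x`, a set `B` (empty or one point) of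
degenerate ones in the closed unit disc, and the accounting of all critical chart points of
the closed unit disc at nearby times. [cite: CerfDiffeoSphere1968, Ch. II §2, Prop. 4] -/
theorem chart_local_structure (s : Fin 2) (t₀ : ℝ) :
    ∃ (S : Finset 𝔼²) (η : 𝔼² → ℝ → 𝔼²) (B : Finset 𝔼²),
      (∀ x ∈ S, d1 (heightChart F s) (t₀, x) = 0 ∧ hessDet (heightChart F s) (t₀, x) ≠ 0) ∧
      (∀ x₀ ∈ B, ‖x₀‖ ≤ 1 ∧ d1 (heightChart F s) (t₀, x₀) = 0 ∧
        hessDet (heightChart F s) (t₀, x₀) = 0) ∧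
      (∀ x ∈ S, η x t₀ = x) ∧
      (∀ x ∈ S, ContDiffAt ℝ ∞ (η x) t₀) ∧
      (∀ x ∈ S, ∀ᶠ q in 𝓝 ((x, t₀) : 𝔼² × ℝ),
        d1 (heightChart F s) (q.2, q.1) = 0 → q.1 = η x q.2) ∧
      (∀ᶠ t in 𝓝 t₀, ∀ x ∈ S,
        d1 (heightChart F s) (t, η x t) = 0 ∧ hessDet (heightChart F s) (t, η x t) ≠ 0) ∧
      (∀ ρ > 0, ∀ᶠ t in 𝓝 t₀, ∀ x' : 𝔼², ‖x'‖ ≤ 1 → d1 (heightChart F s) (t, x') = 0 →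
        (∃ x ∈ S, x' = η x t) ∨ (∃ x₀ ∈ B, dist x' x₀ < ρ)) := by
  classical
  have hFs := contDiff_heightChart_family hF s
  have hK : IsCompact (closedBall (0 : 𝔼²) 1) := isCompact_closedBall 0 1
  -- pull-backs along `t ↦ (0, t)` and `(x, t) ↦ (x, (0, t))`
  have hι : Continuous fun t : ℝ => (((0 : ℝ), t) : ℝ × ℝ) := continuous_const.prodMk continuous_id
  have hι₂ : Continuous fun q : 𝔼² × ℝ => ((q.1, ((0 : ℝ), q.2)) : 𝔼² × (ℝ × ℝ)) :=
    continuous_fst.prodMk (continuous_const.prodMk continuous_snd)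
  have hηs_of : ∀ {ξ : ℝ × ℝ → 𝔼²}, ContDiffAt ℝ ∞ ξ (0, t₀) →
      ContDiffAt ℝ ∞ (fun t => ξ (0, t)) t₀ := fun {ξ} hξ => by
    have h := hξ.comp t₀ (contDiffAt_const.prodMk contDiffAt_id :
      ContDiffAt ℝ ∞ (fun t : ℝ => (((0 : ℝ), t) : ℝ × ℝ)) t₀)
    exact h
  by_cases hex : ∃ x₀ : 𝔼², ‖x₀‖ ≤ 1 ∧ d1 (heightChart F s) (t₀, x₀) = 0 ∧
      hessDet (heightChart F s) (t₀, x₀) = 0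
  · obtain ⟨x₀, hx₀, hc₀, hd₀⟩ := hex
    have hj₀ := hG.jet2_ne s _ hc₀
    have hcorr₀ := hG.correct s _ hj₀ hc₀ hd₀
    have hnd : ∀ x ∈ closedBall (0 : 𝔼²) 1, d1 (heightChart F s) (t₀, x) = 0 → x ≠ x₀ →
        hessDet (heightChart F s) (t₀, x) ≠ 0 := by
      intro x _ hcx hne hdx
      exact hne (injective_stereoInv s (stereoInv_eq_of_degenerate hG hcx hdx hc₀ hd₀))
    obtain ⟨S, ξ, hmem, hξ0, hξs, hξu, hξc, -, -, hξρ⟩ :=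
      exists_local_continuations_birthDeath (F := fun _ : ℝ => heightChart F s) hFs hK
        hc₀ hd₀ hj₀ hcorr₀ hnd
    refine ⟨S, fun x t => ξ x (0, t), {x₀}, fun x hx => ?_, fun x hx => ?_, fun x hx => hξ0 x hx,
      fun x hx => hηs_of (hξs x hx), fun x hx => ?_, ?_, fun ρ hρ => ?_⟩
    · obtain ⟨hxK, hcx, hne⟩ := (hmem x).1 hx
      exact ⟨hcx, hnd x hxK hcx hne⟩
    · rw [Finset.mem_singleton] at hx; subst hx; exact ⟨hx₀, hc₀, hd₀⟩
    · exact (hι₂.tendsto (x, t₀)).eventually (hξu x hx)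
    · exact (hι.tendsto t₀).eventually hξc
    · filter_upwards [(hι.tendsto t₀).eventually (hξρ ρ hρ)] with t ht x' hx' hc'
      rcases ht x' (mem_closedBall_zero_iff.2 hx') hc' with h | h
      · exact Or.inl h
      · exact Or.inr ⟨x₀, Finset.mem_singleton_self x₀, h⟩
  · push Not at hex
    have hnd : ∀ x ∈ closedBall (0 : 𝔼²) 1, d1 (heightChart F s) (t₀, x) = 0 →
        hessDet (heightChart F s) (t₀, x) ≠ 0 := fun x hx hcx =>
      hex x (mem_closedBall_zero_iff.1 hx) hcx
    obtain ⟨S, ξ, hmem, hξ0, hξs, hξu, hξc, -, hξall⟩ :=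
      exists_local_continuations (F := fun _ : ℝ => heightChart F s) hFs hK t₀ hnd
    refine ⟨S, fun x t => ξ x (0, t), ∅, fun x hx => ?_, fun x hx => ?_, fun x hx => hξ0 x hx,
      fun x hx => hηs_of (hξs x hx), fun x hx => ?_, ?_, fun ρ _ => ?_⟩
    · obtain ⟨hxK, hcx⟩ := (hmem x).1 hx
      exact ⟨hcx, hnd x hxK hcx⟩
    · simp at hx
    · exact (hι₂.tendsto (x, t₀)).eventually (hξu x hx)
    · exact (hι.tendsto t₀).eventually hξc
    · filter_upwards [(hι.tendsto t₀).eventually hξall] with t ht x' hx' hc'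
      exact Or.inl (ht x' (mem_closedBall_zero_iff.2 hx') hc')

end Local

/-! ### Events are isolated -/

section Isolated

variable (hF : ContDiff ℝ ∞ (uncurry F)) (hG : GenericConditions F)
include hF hG

/-- **The events of a generic path are isolated**: near every time `λ₀`, no time `λ ≠ λ₀` is an
event.  Near `λ₀` the critical points of the slices are the smooth continuations of the
nondegenerate critical points at `λ₀` together with the points of the birth–death cluster (if
`λ₀` is a birth–death time); the former stay nondegenerate with heights that are distinct or
cross transversally at `λ₀` ((C₁): `μ ≠ μ′`), the latter are nondegenerate for `λ ≠ λ₀` and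
have pairwise distinct heights (Lemme 8), close to the birth–death height which differs from
all other critical heights at `λ₀` ((C₁), (C₄)).
[cite: CerfDiffeoSphere1968, Ch. II §2, Prop. 3′ (an excellent path meets `𝒳¹` at finitely many times) and Prop. 4] -/
theorem eventually_not_mem_events (t₀ : ℝ) : ∀ᶠ t in 𝓝 t₀, t ≠ t₀ → t ∉ events F := by
  classical
  choose S η B hS hB hη0 hηs hηu hηc hηρ using fun s => chart_local_structure hF hG s t₀
  have hcont : ∀ s, Continuous (heightChart F s) := fun s => (contDiff_heightChart hF s).continuous
  -- (F2) continuing points and birth–death centres are distinct points of the sphere, with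
  -- distinct heights; (F1) the centres coincide on the sphere; (F3) at a birth–death time the
  -- continuing points have pairwise distinct heights
  have hSB : ∀ s s' : Fin 2, ∀ p ∈ S s, ∀ x₀ ∈ B s', stereoInv s p ≠ stereoInv s' x₀ := by
    intro s s' p hp x₀ hx₀ h
    exact (hS s p hp).2 ((hessDet_eq_zero_iff_of_stereoInv_eq hF h (hS s p hp).1).2 (hB s' x₀ hx₀).2.2)
  have hvalSB : ∀ s s' : Fin 2, ∀ p ∈ S s, ∀ x₀ ∈ B s',
      heightChart F s (t₀, p) ≠ heightChart F s' (t₀, x₀) := fun s s' p hp x₀ hx₀ =>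
    (height_ne_of_degenerate hF hG (Ne.symm (hSB s s' p hp x₀ hx₀)) (hB s' x₀ hx₀).2.1
      (hB s' x₀ hx₀).2.2 (hS s p hp).1).symm
  have hBB : ∀ s s' : Fin 2, ∀ x₀ ∈ B s, ∀ x₀' ∈ B s', stereoInv s x₀ = stereoInv s' x₀' :=
    fun s s' x₀ hx₀ x₀' hx₀' => stereoInv_eq_of_degenerate hG (hB s x₀ hx₀).2.1 (hB s x₀ hx₀).2.2
      (hB s' x₀' hx₀').2.1 (hB s' x₀' hx₀').2.2
  have hSS : ∀ s₀ : Fin 2, ∀ x₀ ∈ B s₀, ∀ s s' : Fin 2, ∀ p ∈ S s, ∀ p' ∈ S s',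
      stereoInv s p ≠ stereoInv s' p' → heightChart F s (t₀, p) ≠ heightChart F s' (t₀, p') :=
    fun s₀ x₀ hx₀ s s' p hp p' hp' hne =>
      height_ne_of_exists_degenerate hF hG (hB s₀ x₀ hx₀).2.1 (hB s₀ x₀ hx₀).2.2 hne
        (hS s p hp).1 (hS s' p' hp').1
  -- cluster radii
  have hcl : ∀ s : Fin 2, ∀ x₀ ∈ B s, ∃ ε > 0,
      (∀ z : ℝ × 𝔼², dist z (t₀, x₀) < ε → d1 (heightChart F s) z = 0 →
        hessDet (heightChart F s) z = 0 → z = (t₀, x₀)) ∧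
      (∀ z z' : ℝ × 𝔼², dist z (t₀, x₀) < ε → dist z' (t₀, x₀) < ε →
        d1 (heightChart F s) z = 0 → d1 (heightChart F s) z' = 0 → z ≠ z' → z.1 = z'.1 →
        heightChart F s z ≠ heightChart F s z') := fun s x₀ hx₀ =>
    exists_cluster_radius hF hG (hB s x₀ hx₀).2.1 (hB s x₀ hx₀).2.2
  choose! ε hε hε1 hε8 using hcl
  -- the cluster predicate near a centre, and a radius for it
  have hCL : ∀ s' : Fin 2, ∀ x₀' ∈ B s', ∃ ρ' > 0, ∀ z : ℝ × 𝔼², dist z (t₀, x₀') < ρ' →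
      dist z (t₀, x₀') < ε s' x₀' ∧
      (∀ s : Fin 2, ∀ p ∈ S s, |heightChart F s' z - heightChart F s' (t₀, x₀')| <
        |heightChart F s (t₀, p) - heightChart F s' (t₀, x₀')| / 2) ∧
      (∀ s : Fin 2, ∀ x₀ ∈ B s, s ≠ s' → z.2 ≠ 0 ∧ dist (z.1, sphereInversion z.2) (t₀, x₀) < ε s x₀) := by
    intro s' x₀' hx₀'
    have h1 : ∀ᶠ z : ℝ × 𝔼² in 𝓝 (t₀, x₀'), dist z (t₀, x₀') < ε s' x₀' :=
      ball_mem_nhds _ (hε s' x₀' hx₀')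
    have h2 : ∀ᶠ z : ℝ × 𝔼² in 𝓝 (t₀, x₀'), ∀ s : Fin 2, ∀ p ∈ S s,
        |heightChart F s' z - heightChart F s' (t₀, x₀')| <
          |heightChart F s (t₀, p) - heightChart F s' (t₀, x₀')| / 2 := by
      refine (Finset.eventually_all Finset.univ).2 (fun s _ => ?_) |>.mono fun z hz s => hz s (Finset.mem_univ s)
      refine (Finset.eventually_all (S s)).2 fun p hp => ?_
      have hpos : 0 < |heightChart F s (t₀, p) - heightChart F s' (t₀, x₀')| / 2 :=
        half_pos (abs_pos.2 (sub_ne_zero.2 (hvalSB s s' p hp x₀' hx₀')))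
      have hc : ContinuousAt (fun z => |heightChart F s' z - heightChart F s' (t₀, x₀')|) (t₀, x₀') :=
        ((hcont s').continuousAt.sub continuousAt_const).abs
      have h0 : |heightChart F s' (t₀, x₀') - heightChart F s' (t₀, x₀')| <
          |heightChart F s (t₀, p) - heightChart F s' (t₀, x₀')| / 2 := by simpa using hpos
      exact hc.eventually (eventually_lt_nhds h0)
    have h3 : ∀ᶠ z : ℝ × 𝔼² in 𝓝 (t₀, x₀'), ∀ s : Fin 2, ∀ x₀ ∈ B s, s ≠ s' →
        z.2 ≠ 0 ∧ dist (z.1, sphereInversion z.2) (t₀, x₀) < ε s x₀ := by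
      refine (Finset.eventually_all Finset.univ).2 (fun s _ => ?_) |>.mono fun z hz s => hz s (Finset.mem_univ s)
      refine (Finset.eventually_all (B s)).2 fun x₀ hx₀ => ?_
      by_cases hss : s = s'
      · exact Eventually.of_forall fun z h => absurd hss h
      · -- the two centres are related by the inversion
        obtain ⟨hx0, hinv⟩ := eq_inversion_of_stereoInv_eq (Ne.symm hss) (hBB s' s x₀' hx₀' x₀ hx₀)
        -- hx0 : x₀' ≠ 0, hinv : x₀ = sphereInversion x₀'
        have hne0 : ∀ᶠ z : ℝ × 𝔼² in 𝓝 (t₀, x₀'), z.2 ≠ 0 :=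
          (continuous_snd.continuousAt (x := (t₀, x₀'))).eventually_ne hx0
        have hci : ContinuousAt (fun z : ℝ × 𝔼² => ((z.1, sphereInversion z.2) : ℝ × 𝔼²)) (t₀, x₀') := by
          have h2 : ContinuousAt (sphereInversion (F := 𝔼²)) ((Prod.snd : ℝ × 𝔼² → 𝔼²) (t₀, x₀')) :=
            (sphereInversion.continuousAt hx0)
          exact continuousAt_fst.prodMk (ContinuousAt.comp (f := (Prod.snd : ℝ × 𝔼² → 𝔼²))
            h2 continuousAt_snd)
        have hball : ∀ᶠ w : ℝ × 𝔼² in 𝓝 ((t₀, sphereInversion x₀') : ℝ × 𝔼²), dist w (t₀, x₀) < ε s x₀ := by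
          rw [← hinv]; exact ball_mem_nhds _ (hε s x₀ hx₀)
        filter_upwards [hne0, hci.eventually hball] with z hz hz'
        exact fun _ => ⟨hz, hz'⟩
    obtain ⟨ρ', hρ', hball⟩ := Metric.eventually_nhds_iff_ball.1 (h1.and (h2.and h3))
    exact ⟨ρ', hρ', fun z hz => hball z hz⟩
  choose! ρ' hρ' hρ'CL using hCL
  -- one radius per chart
  have hρ : ∀ s : Fin 2, ∃ ρ > 0, ∀ x₀ ∈ B s, ρ ≤ ρ' s x₀ := by
    intro s
    by_cases hBe : B s = ∅
    · exact ⟨1, one_pos, fun x₀ hx₀ => by simp [hBe] at hx₀⟩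
    · have hne : (B s).Nonempty := Finset.nonempty_iff_ne_empty.2 hBe
      refine ⟨(B s).inf' hne (ρ' s), ?_, fun x₀ hx₀ => Finset.inf'_le _ hx₀⟩
      obtain ⟨x₀, hx₀, hxeq⟩ := Finset.exists_mem_eq_inf' hne (ρ' s)
      rw [hxeq]; exact hρ' s x₀ hx₀
  choose ρ hρpos hρle using hρ
  -- continuing points: heights near their values at `t₀`
  have hCO2 : ∀ᶠ t in 𝓝 t₀, ∀ s : Fin 2, ∀ p ∈ S s, ∀ s' : Fin 2, ∀ x₀' ∈ B s',
      |heightChart F s (t, η s p t) - heightChart F s (t₀, p)| <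
        |heightChart F s (t₀, p) - heightChart F s' (t₀, x₀')| / 2 := by
    refine (Finset.eventually_all Finset.univ).2 (fun s _ => ?_) |>.mono fun t ht s => ht s (Finset.mem_univ s)
    refine (Finset.eventually_all (S s)).2 fun p hp => ?_
    refine (Finset.eventually_all Finset.univ).2 (fun s' _ => ?_) |>.mono fun t ht s' => ht s' (Finset.mem_univ s')
    refine (Finset.eventually_all (B s')).2 fun x₀' hx₀' => ?_
    have hpos : 0 < |heightChart F s (t₀, p) - heightChart F s' (t₀, x₀')| / 2 :=
      half_pos (abs_pos.2 (sub_ne_zero.2 (hvalSB s s' p hp x₀' hx₀')))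
    have hγ : ContinuousAt (fun t => ((t, η s p t) : ℝ × 𝔼²)) t₀ :=
      continuousAt_id.prodMk (hηs s p hp).continuousAt
    have hc : ContinuousAt (fun t => |heightChart F s (t, η s p t) - heightChart F s (t₀, p)|) t₀ := by
      have h1 : ContinuousAt (fun t => heightChart F s (t, η s p t)) t₀ :=
        (hcont s).continuousAt.comp hγ
      exact (h1.sub continuousAt_const).abs
    have h0 : |heightChart F s (t₀, η s p t₀) - heightChart F s (t₀, p)| <
        |heightChart F s (t₀, p) - heightChart F s' (t₀, x₀')| / 2 := by
      rw [hη0 s p hp]; simpa using hpos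
    exact hc.eventually (eventually_lt_nhds h0)
  -- continuing points: pairwise, for `t ≠ t₀` distinct points of the sphere have distinct heights
  have hCO3 : ∀ᶠ t in 𝓝 t₀, t ≠ t₀ → ∀ s : Fin 2, ∀ p ∈ S s, ∀ s' : Fin 2, ∀ p' ∈ S s',
      stereoInv s (η s p t) ≠ stereoInv s' (η s' p' t) →
      heightChart F s (t, η s p t) ≠ heightChart F s' (t, η s' p' t) := by
    have key : ∀ s : Fin 2, ∀ p ∈ S s, ∀ s' : Fin 2, ∀ p' ∈ S s', ∀ᶠ t in 𝓝 t₀, t ≠ t₀ →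
        stereoInv s (η s p t) ≠ stereoInv s' (η s' p' t) →
        heightChart F s (t, η s p t) ≠ heightChart F s' (t, η s' p' t) := by
      intro s p hp s' p' hp'
      by_cases hP : stereoInv s p = stereoInv s' p'
      · -- same point of the sphere at `t₀`: the continuations represent the same point
        by_cases hss : s = s'
        · subst hss
          have hpp : p = p' := injective_stereoInv s hP
          subst hpp
          exact Eventually.of_forall fun t _ h => absurd rfl h
        · obtain ⟨hp0, hinv⟩ := eq_inversion_of_stereoInv_eq hss hP
          -- `p' = sphereInversion p`; transport the continuation of `p'` into chart `s`
          have hγ' : ContinuousAt (fun t => ((sphereInversion (η s' p' t), t) : 𝔼² × ℝ)) t₀ := by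
            have hp'0 : p' ≠ 0 := by rw [hinv]; exact sphereInversion.ne_zero hp0
            have h1 : ContinuousAt (fun t => η s' p' t) t₀ := (hηs s' p' hp').continuousAt
            have h2 : ContinuousAt (sphereInversion (F := 𝔼²)) (η s' p' t₀) := by
              rw [hη0 s' p' hp']; exact (sphereInversion.continuousAt hp'0)
            exact (h2.comp h1).prodMk continuousAt_id
          have hlim : ((sphereInversion (η s' p' t₀), t₀) : 𝔼² × ℝ) = (p, t₀) := by
            rw [hη0 s' p' hp', hinv, sphereInversion.apply_apply]
          have huniq : ∀ᶠ t in 𝓝 t₀, d1 (heightChart F s) (t, sphereInversion (η s' p' t)) = 0 →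
              sphereInversion (η s' p' t) = η s p t := by
            have h := hγ'.tendsto
            rw [hlim] at h
            exact h.eventually (hηu s p hp)
          have hne0 : ∀ᶠ t in 𝓝 t₀, η s' p' t ≠ 0 := by
            have hp'0 : p' ≠ 0 := by rw [hinv]; exact sphereInversion.ne_zero hp0
            have h := (hηs s' p' hp').continuousAt.eventually_ne (by rw [hη0 s' p' hp']; exact hp'0)
            exact h
          filter_upwards [huniq, hne0, hηc s'] with t ht ht0 htc _ hne
          exfalso
          apply hne
          have hc' : d1 (heightChart F s') (t, η s' p' t) = 0 := (htc p' hp').1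
          have hcs : d1 (heightChart F s) (t, sphereInversion (η s' p' t)) = 0 :=
            (d1_heightChart_eq_zero_iff hF (Ne.symm hss) t ht0).1 hc'
          rw [← ht hcs, stereoInv_inversion (Ne.symm hss) ht0]
      · by_cases hV : heightChart F s (t₀, p) = heightChart F s' (t₀, p')
        · -- transverse crossing: the difference has non-zero derivative at `t₀`
          have hμ := dt_ne_of_double hF hG hP (hS s p hp).1 (hS s' p' hp').1 hV
          have hderiv : ∀ (c : Fin 2) (q : 𝔼²), q ∈ S c →
              HasDerivAt (fun t => heightChart F c (t, η c q t)) (dt (heightChart F c) (t₀, q)) t₀ := by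
            intro c q hq
            have hηd : HasDerivAt (η c q) (deriv (η c q) t₀) t₀ :=
              ((hηs c q hq).differentiableAt (by simp)).hasDerivAt
            have hγ : HasDerivAt (fun t => ((t, η c q t) : ℝ × 𝔼²)) (1, deriv (η c q) t₀) t₀ :=
              (hasDerivAt_id t₀).prodMk hηd
            have hfd : HasFDerivAt (heightChart F c) (fderiv ℝ (heightChart F c) (t₀, q)) (t₀, η c q t₀) := by
              rw [hη0 c q hq]
              exact ((contDiff_heightChart hF c).differentiable (by simp) _).hasFDerivAt
            have h := hfd.comp_hasDerivAt t₀ hγ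
            rw [fderiv_apply_of_critical (t₀, q) (hS c q hq).1, one_mul] at h
            exact h
          have hΔ : HasDerivAt (fun t => heightChart F s (t, η s p t) - heightChart F s' (t, η s' p' t))
              (dt (heightChart F s) (t₀, p) - dt (heightChart F s') (t₀, p')) t₀ :=
            (hderiv s p hp).sub (hderiv s' p' hp')
          have hev := hΔ.eventually_ne (sub_ne_zero.2 hμ) (c := 0)
          rw [eventually_nhdsWithin_iff] at hev
          filter_upwards [hev] with t ht htne _
          exact sub_ne_zero.1 (ht htne)
        · -- distinct heights at `t₀` stay distinct
          have hγ : ∀ (c : Fin 2) (q : 𝔼²), q ∈ S c →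
              ContinuousAt (fun t => heightChart F c (t, η c q t)) t₀ := fun c q hq =>
            (hcont c).continuousAt.comp (continuousAt_id.prodMk (hηs c q hq).continuousAt)
          have hc : ContinuousAt (fun t => heightChart F s (t, η s p t) - heightChart F s' (t, η s' p' t)) t₀ :=
            (hγ s p hp).sub (hγ s' p' hp')
          have h0 : heightChart F s (t₀, η s p t₀) - heightChart F s' (t₀, η s' p' t₀) ≠ 0 := by
            rw [hη0 s p hp, hη0 s' p' hp']; exact sub_ne_zero.2 hV
          filter_upwards [hc.eventually_ne h0] with t ht _ _
          exact sub_ne_zero.1 ht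
    have h1 := (Finset.eventually_all Finset.univ).2 fun s (_ : s ∈ Finset.univ) =>
      (Finset.eventually_all (S s)).2 fun p hp =>
        (Finset.eventually_all Finset.univ).2 fun s' (_ : s' ∈ Finset.univ) =>
          (Finset.eventually_all (S s')).2 fun p' hp' => key s p hp s' p' hp'
    filter_upwards [h1] with t ht htne s p hp s' p' hp'
    exact ht s (Finset.mem_univ s) p hp s' (Finset.mem_univ s') p' hp' htne
  -- time window below the radii
  obtain ⟨ρ₀, hρ₀, hρ₀le⟩ : ∃ ρ₀ > 0, ∀ s, ρ₀ ≤ ρ s :=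
    ⟨min (ρ 0) (ρ 1), lt_min (hρpos 0) (hρpos 1), fun s => by
      fin_cases s
      · exact min_le_left _ _
      · exact min_le_right _ _⟩
  have hwin : ∀ᶠ t in 𝓝 t₀, dist t t₀ < ρ₀ := ball_mem_nhds t₀ hρ₀
  have hacc : ∀ᶠ t in 𝓝 t₀, ∀ s : Fin 2, ∀ x' : 𝔼², ‖x'‖ ≤ 1 → d1 (heightChart F s) (t, x') = 0 →
      (∃ x ∈ S s, x' = η s x t) ∨ (∃ x₀ ∈ B s, dist x' x₀ < ρ s) :=
    (Finset.eventually_all Finset.univ).2 (fun s _ => hηρ s (ρ s) (hρpos s)) |>.mono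
      fun t ht s => ht s (Finset.mem_univ s)
  have hnd : ∀ᶠ t in 𝓝 t₀, ∀ s : Fin 2, ∀ x ∈ S s,
      d1 (heightChart F s) (t, η s x t) = 0 ∧ hessDet (heightChart F s) (t, η s x t) ≠ 0 :=
    (Finset.eventually_all Finset.univ).2 (fun s _ => hηc s) |>.mono fun t ht s => ht s (Finset.mem_univ s)
  -- cluster points satisfy the cluster predicate
  have hclus : ∀ t : ℝ, dist t t₀ < ρ₀ → ∀ s : Fin 2, ∀ x₀ ∈ B s, ∀ x' : 𝔼², dist x' x₀ < ρ s →
      dist ((t, x') : ℝ × 𝔼²) (t₀, x₀) < ρ' s x₀ := by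
    intro t ht s x₀ hx₀ x' hx'
    rw [Prod.dist_eq]
    exact max_lt (ht.trans_le ((hρ₀le s).trans (hρle s x₀ hx₀))) (hx'.trans_le (hρle s x₀ hx₀))
  filter_upwards [hwin, hacc, hnd, hCO2, hCO3] with t hwt hacct hndt hCO2t hCO3t htne hmem
  -- classification of a critical representative of the closed discs at time `t`
  have hclass : ∀ (s : Fin 2) (x' : 𝔼²), ‖x'‖ ≤ 1 → d1 (heightChart F s) (t, x') = 0 →
      (∃ p ∈ S s, x' = η s p t) ∨
      (∃ x₀ ∈ B s, dist ((t, x') : ℝ × 𝔼²) (t₀, x₀) < ρ' s x₀) := by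
    intro s x' hx' hc'
    rcases hacct s x' hx' hc' with h | ⟨x₀, hx₀, hd⟩
    · exact Or.inl h
    · exact Or.inr ⟨x₀, hx₀, hclus t hwt s x₀ hx₀ x' hd⟩
  -- (a) no degenerate critical point at `t`
  have hnodeg : ∀ (s : Fin 2) (x' : 𝔼²), ‖x'‖ ≤ 1 → d1 (heightChart F s) (t, x') = 0 →
      hessDet (heightChart F s) (t, x') ≠ 0 := by
    intro s x' hx' hc' hd'
    rcases hclass s x' hx' hc' with ⟨p, hp, rfl⟩ | ⟨x₀, hx₀, hz⟩
    · exact (hndt s p hp).2 hd'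
    · have hz' := (hρ'CL s x₀ hx₀ _ hz).1
      have := hε1 s x₀ hx₀ _ hz' hc' hd'
      exact htne (congrArg Prod.fst this)
  -- (b) heights of distinct critical points differ: continuing / cluster cases
  have hcc : ∀ (s : Fin 2) (p : 𝔼²), p ∈ S s → ∀ (s' : Fin 2) (x'' : 𝔼²) (x₀' : 𝔼²), x₀' ∈ B s' →
      dist ((t, x'') : ℝ × 𝔼²) (t₀, x₀') < ρ' s' x₀' →
      heightChart F s (t, η s p t) ≠ heightChart F s' (t, x'') := by
    intro s p hp s' x'' x₀' hx₀' hz heq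
    have h1 := hCO2t s p hp s' x₀' hx₀'
    have h2 := (hρ'CL s' x₀' hx₀' _ hz).2.1 s p hp
    rw [heq] at h1
    have h3 : |heightChart F s (t₀, p) - heightChart F s' (t₀, x₀')| <
        |heightChart F s (t₀, p) - heightChart F s' (t₀, x₀')| := by
      calc |heightChart F s (t₀, p) - heightChart F s' (t₀, x₀')|
          ≤ |heightChart F s' (t, x'') - heightChart F s (t₀, p)| +
            |heightChart F s' (t, x'') - heightChart F s' (t₀, x₀')| := by
              rw [abs_sub_comm (heightChart F s' (t, x'')) (heightChart F s (t₀, p))]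
              exact abs_sub_le _ _ _
        _ < _ := by linarith
    exact lt_irrefl _ h3
  have hclcl : ∀ (s : Fin 2) (x' x₀ : 𝔼²), x₀ ∈ B s → dist ((t, x') : ℝ × 𝔼²) (t₀, x₀) < ρ' s x₀ →
      d1 (heightChart F s) (t, x') = 0 →
      ∀ (s' : Fin 2) (x'' x₀' : 𝔼²), x₀' ∈ B s' → dist ((t, x'') : ℝ × 𝔼²) (t₀, x₀') < ρ' s' x₀' →
      d1 (heightChart F s') (t, x'') = 0 →
      stereoInv s x' ≠ stereoInv s' x'' →
      heightChart F s (t, x') ≠ heightChart F s' (t, x'') := by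
    intro s x' x₀ hx₀ hz hc' s' x'' x₀' hx₀' hz' hc'' hne
    by_cases hss : s = s'
    · subst hss
      have hxx : x₀ = x₀' := injective_stereoInv s (hBB s s x₀ hx₀ x₀' hx₀')
      subst hxx
      have hz1 := (hρ'CL s x₀ hx₀ _ hz).1
      have hz2 := (hρ'CL s x₀ hx₀ _ hz').1
      refine hε8 s x₀ hx₀ (t, x') (t, x'') hz1 hz2 hc' hc'' (fun h => hne ?_) rfl
      have hx : x' = x'' := (Prod.ext_iff.1 h).2
      rw [hx]
    · -- transport the second point into chart `s`
      obtain ⟨hx''0, hdist⟩ := (hρ'CL s' x₀' hx₀' _ hz').2.2 s x₀ hx₀ hss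
      have hz1 := (hρ'CL s x₀ hx₀ _ hz).1
      have hcw : d1 (heightChart F s) (t, sphereInversion x'') = 0 :=
        (d1_heightChart_eq_zero_iff hF (Ne.symm hss) t hx''0).1 hc''
      have hval : heightChart F s' (t, x'') = heightChart F s (t, sphereInversion x'') :=
        heightChart_inversion (Ne.symm hss) t hx''0
      rw [hval]
      have hx0 : x'' ≠ 0 := hx''0
      refine hε8 s x₀ hx₀ (t, x') (t, sphereInversion x'') hz1 hdist hc' hcw (fun h => hne ?_) rfl
      have hx : x' = sphereInversion x'' := (Prod.ext_iff.1 h).2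
      rw [hx]
      exact stereoInv_inversion (Ne.symm hss) hx0
  have hdouble : ∀ (s : Fin 2) (x' : 𝔼²), ‖x'‖ ≤ 1 → d1 (heightChart F s) (t, x') = 0 →
      ∀ (s' : Fin 2) (x'' : 𝔼²), ‖x''‖ ≤ 1 → d1 (heightChart F s') (t, x'') = 0 →
      stereoInv s x' ≠ stereoInv s' x'' →
      heightChart F s (t, x') ≠ heightChart F s' (t, x'') := by
    intro s x' hx' hc' s' x'' hx'' hc'' hne
    rcases hclass s x' hx' hc' with ⟨p, hp, rfl⟩ | ⟨x₀, hx₀, hz⟩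
    · rcases hclass s' x'' hx'' hc'' with ⟨p', hp', rfl⟩ | ⟨x₀', hx₀', hz'⟩
      · exact hCO3t htne s p hp s' p' hp' hne
      · exact hcc s p hp s' x'' x₀' hx₀' hz'
    · rcases hclass s' x'' hx'' hc'' with ⟨p', hp', rfl⟩ | ⟨x₀', hx₀', hz'⟩
      · exact (hcc s' p' hp' s x' x₀ hx₀ hz).symm
      · exact hclcl s x' x₀ hx₀ hz hc' s' x'' x₀' hx₀' hz' hc'' hne
  -- conclusion
  rcases hmem with ⟨ξ, hξ, hdeg⟩ | ⟨ξ, hξ, ξ', hξ', hne, heq⟩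
  · obtain ⟨s, x', hx', rfl, hc'⟩ := hξ
    obtain ⟨a, y, hy, hcy, hdy⟩ := hdeg
    have hd' : hessDet (heightChart F s) (t, x') = 0 :=
      (hessDet_eq_zero_iff_of_stereoInv_eq hF hy hcy).1 hdy
    exact hnodeg s x' hx' hc' hd'
  · obtain ⟨s, x', hx', rfl, hc'⟩ := hξ
    obtain ⟨s', x'', hx'', rfl, hc''⟩ := hξ'
    exact hdouble s x' hx' hc' s' x'' hx'' hc'' hne heq

/-- **On every compact time interval a generic path has finitely many events**
(Cerf: an excellent path meets `ℱ¹` at finitely many times).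
[cite: CerfDiffeoSphere1968, Ch. II §2, Prop. 3′ and §3, Prop. 7] -/
theorem finite_events_inter_Icc (a b : ℝ) : (events F ∩ Icc a b).Finite := by
  -- every time has a neighbourhood meeting the events in at most that time
  have hloc : ∀ t₀ ∈ Icc a b, ∃ U ∈ 𝓝 t₀, ∀ t ∈ U, t ∈ events F → t = t₀ := by
    intro t₀ _
    obtain ⟨U, hU, hUsub⟩ := (eventually_not_mem_events hF hG t₀).exists_mem
    exact ⟨U, hU, fun t ht hte => by_contra fun hne => hUsub t ht hne hte⟩
  choose! U hU hUuniq using hloc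
  obtain ⟨T, hTsub, hcover⟩ := (isCompact_Icc (a := a) (b := b)).elim_nhds_subcover U hU
  refine (T.finite_toSet).subset fun t ht => ?_
  obtain ⟨t₀, ht₀T, htU⟩ := mem_iUnion₂.1 (hcover ht.2)
  have := hUuniq t₀ (hTsub t₀ ht₀T) t htU ht.1
  rw [this]; exact ht₀T

end Isolated

end CerfPath

end Literature.Topology.FourManifolds
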